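import Literature.Analysis.FluidPDE.TaoCascadeCoarseNoExit
import Literature.Analysis.FluidPDE.TaoCascadeCoarseSecondary
import HarnessLib

/-!
# Tao's cascade ODE, §6.7 Prop. 6.17 (no exit to coarse scales): the modified-energy bound for `Ẽ₋₁`

T. Tao, *Finite time blowup for an averaged three-dimensional Navier–Stokes equation*,
J. Amer. Math. Soc. **29** (2016), 601–674 = arXiv:1402.0290v3, §6.7, proof of Prop. 6.17:
"we introduce the modified energy `Ẽ*₋₁ := Ẽ₋₁ - ½K a₋₁d₋₁a₀/((1+ε₀)^{5/2}ε⁻²c₋₁)` … we conclude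
`∂ₜẼ*₋₁ ≤ -K a₀ Ẽ*₋₁ + O(K⁻¹³)` … By Gronwall's inequality, it thus suffices to show
`∫₀ᵗ a₀ ≳ 1`" — with the repair recorded in `TaoCascadeCoarseNoExit.lean`: the kernel
`exp(-K∫ₛᵗ a₀)` is controlled by a *uniform lower bound* `∫ₛᵗ a₀ ≥ -λ` (`le_of_oscillating_rate`),
which §6.7 provides by splitting `[s, t]` into the part before `t_c` (`a₀ ≥ 0`), the short transition
after `t_c`, and the fast-rotor part (`integral_rotor_le`, `TaoCascadeRotorAveraging.lean`).

This file assembles the pointwise algebra of `TaoCascadeCoarseNoExit.lean`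
(`correction_hasDerivWithinAt`, `coarseModifiedEnergy_algebra`, `coarse_rate_algebra`,
`le_of_oscillating_rate`) with the coarse-scale equations (`TaoCascadeCoarseModes.lean`,
`TaoCascadeCoarseSecondary.lean`) over `RescaledHypotheses γ …` (`TaoCascadeRescaled.lean`):

* `integral_lower_of_three_zones` — the splitting lemma for `∫ₛᵗ a₀ ≥ -λ`;
* `RescaledHypotheses.coarse_energy_bound` — on `[s₀, T']` with `Ẽ₀ ≤ 1`, `Ẽ₋₁ ≤ E₁`, `Ẽ₋₂ ≤ E₂`,
  `|b₋₁| ≤ b̄`, `c_min ≤ c₋₁ ≤ c̄` (`c_min > 0`), `|∂ₜa₀| ≤ β₀`, the Lemma 6.9 defect bound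
  `Ẽ₋₁ ≤ ½Σ(·)² + η₉` and `∫ₛᵗ a₀ ≥ -λ`:
  `Ẽ₋₁(t) ≤ e^{Kλ}(Ẽ₋₁(s₀) + χ) + g(t - s₀)e^{Kλ} + χ` with `χ, g` explicit in the levels
  (`χ = ½K·2E₁√2/(ρc_min)`, `ρ = (1+ε₀)^{-5/2}ε⁻²`).

Theorems only; all levels are free parameters, to be instantiated in the regime of Prop. 6.5.

## References

* T. Tao, J. Amer. Math. Soc. 29 (2016), 601–674, arXiv:1402.0290v3, §6.7 Prop. 6.17 and its proof,
  (6.168)–(6.174). [`Tao2016AveragedNS`]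
-/

noncomputable section

open Set MeasureTheory intervalIntegral Filter
open scoped _root_.Topology

namespace Literature.Analysis.FluidPDE

namespace TaoCascade

open Literature.Analysis.ODE

/-! ## The splitting lemma for `∫ₛᵗ a₀ ≥ -λ` -/

/-- **Uniform lower bound for `∫ₛᵗ f` from three zones.** If `f ≥ 0` on `[s₀, t₁]`, `|f| ≤ M` on
`[t₁, t₂]` (`t₁ ≤ t₂`, `t₂ - t₁ ≤ ℓ`), and `∫ᵤᵛ f ≥ -λ₂` whenever `t₂ ≤ u ≤ v ≤ T`, then
`∫ₛᵗ f ≥ -(Mℓ + λ₂)` for all `s₀ ≤ s ≤ t ≤ T` (`f` continuous on `[s₀, T]`). [folklore] -/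
theorem integral_lower_of_three_zones {f : ℝ → ℝ} {s₀ t₁ t₂ T M ℓ lam₂ : ℝ}
    (hf : ContinuousOn f (Icc s₀ T)) (h12 : t₁ ≤ t₂) (hℓ : t₂ - t₁ ≤ ℓ) (hM : 0 ≤ M) (hlam₂ : 0 ≤ lam₂)
    (hpos : ∀ u ∈ Icc s₀ t₁, 0 ≤ f u) (hbd : ∀ u ∈ Icc t₁ t₂, |f u| ≤ M)
    (hfast : ∀ u v, t₂ ≤ u → u ≤ v → v ≤ T → -lam₂ ≤ ∫ x in u..v, f x)
    {s t : ℝ} (hs : s₀ ≤ s) (hst : s ≤ t) (ht : t ≤ T) :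
    -(M * ℓ + lam₂) ≤ ∫ x in s..t, f x := by
  -- split points
  set p : ℝ := min t (max s t₁) with hp
  set q : ℝ := min t (max s t₂) with hq
  have hsp : s ≤ p := le_min hst (le_max_left _ _)
  have hpq : p ≤ q := min_le_min le_rfl (max_le_max le_rfl h12)
  have hqt : q ≤ t := min_le_left _ _
  have hint : ∀ a b, s ≤ a → a ≤ b → b ≤ t → IntervalIntegrable f volume a b := by
    intro a b ha hab hb
    refine (hf.mono ?_).intervalIntegrable
    rw [uIcc_of_le hab]
    exact Icc_subset_Icc (hs.trans ha) (hb.trans ht)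
  have hsplit : ∫ x in s..t, f x = (∫ x in s..p, f x) + (∫ x in p..q, f x) + ∫ x in q..t, f x := by
    rw [integral_add_adjacent_intervals (hint s p le_rfl hsp (hpq.trans hqt))
      (hint p q hsp hpq hqt), integral_add_adjacent_intervals
      (hint s q le_rfl (hsp.trans hpq) hqt) (hint q t (hsp.trans hpq) hqt le_rfl)]
  -- zone 1: `[s, p] ⊆ [s₀, t₁]` (or degenerate)
  have h1 : 0 ≤ ∫ x in s..p, f x := by
    rcases le_or_gt t₁ s with hts | hts
    · -- then `p = s`
      have hps : p = s := by
        apply le_antisymm _ hsp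
        rw [hp, max_eq_left hts]; exact min_le_right _ _
      rw [hps, intervalIntegral.integral_same]
    · have hpt₁ : p ≤ t₁ := (min_le_right _ _).trans (max_le hts.le le_rfl)
      exact intervalIntegral.integral_nonneg hsp fun u hu => hpos u ⟨hs.trans hu.1, hu.2.trans hpt₁⟩
  -- zone 2: `[p, q] ⊆ [t₁, t₂]`, length `≤ ℓ`
  have h2 : -(M * ℓ) ≤ ∫ x in p..q, f x := by
    rcases eq_or_lt_of_le hpq with hpq' | hpq'
    · rw [← hpq', intervalIntegral.integral_same]
      have : 0 ≤ M * ℓ := mul_nonneg hM (by linarith)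
      linarith
    · -- nondegenerate: then `t₁ ≤ p` and `q ≤ t₂`
      have htp : t₁ ≤ p := by
        by_contra hcon
        push Not at hcon
        -- `p < t₁` forces `p = t` hence `q = t = p`
        have hpt : p = t := by
          rw [hp]
          rcases le_or_gt t (max s t₁) with h' | h'
          · exact min_eq_left h'
          · exfalso
            have : p = max s t₁ := min_eq_right h'.le
            rw [this] at hcon
            exact absurd (le_max_right s t₁) (not_le.2 hcon)
        have : q ≤ p := by rw [hpt]; exact hqt
        linarith
      have hqt₂ : q ≤ t₂ := by
        rcases le_or_gt s t₂ with h' | h'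
        · exact (min_le_right _ _).trans (by rw [max_eq_right h'])
        · -- `s > t₂ ≥ t₁`: then `p = q`
          exfalso
          have hps : p = min t s := by rw [hp, max_eq_left (h12.trans h'.le)]
          have hqs : q = min t s := by rw [hq, max_eq_left h'.le]
          linarith
      have hbd' : ∀ x ∈ Set.uIoc p q, ‖f x‖ ≤ M := by
        intro x hx
        rw [uIoc_of_le hpq] at hx
        rw [Real.norm_eq_abs]
        exact hbd x ⟨htp.trans hx.1.le, hx.2.trans hqt₂⟩
      have hn := intervalIntegral.norm_integral_le_of_norm_le_const hbd'
      rw [Real.norm_eq_abs, abs_of_nonneg (sub_nonneg.2 hpq)] at hn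
      have hlen : q - p ≤ ℓ := by linarith
      have : |∫ x in p..q, f x| ≤ M * ℓ :=
        hn.trans (mul_le_mul_of_nonneg_left hlen hM)
      linarith [(abs_le.mp this).1]
  -- zone 3: `[q, t]` with `t₂ ≤ q`
  have h3 : -lam₂ ≤ ∫ x in q..t, f x := by
    rcases eq_or_lt_of_le hqt with hqt' | hqt'
    · rw [hqt', intervalIntegral.integral_same]; linarith
    · have hq2 : t₂ ≤ q := by
        have : q = max s t₂ := by
          rw [hq]
          rcases le_or_gt t (max s t₂) with h' | h'
          · exfalso
            have : q = t := min_eq_left h'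
            linarith
          · exact min_eq_right h'.le
        rw [this]; exact le_max_right _ _
      exact hfast q t hq2 hqt ht
  rw [hsplit]
  linarith

/-! ## The modified-energy bound for `Ẽ₋₁` -/

section CoarseEnergy

variable {γ ε₀ K ε C₁ C₂ C₃ : ℝ} {n₀ N : ℤ} {τ : ℤ → ℝ} {Xr : Fin 4 → ℤ → ℝ → ℝ} {Er : ℤ → ℝ → ℝ}

/-- **Prop. 6.17, the modified-energy bound for `Ẽ₋₁` with explicit levels.** On `[s₀, T']`
(`0 ≤ s₀ ≤ T'`) assume `Ẽ₀ ≤ 1`, `Ẽ₋₁ ≤ E₁`, `Ẽ₋₂ ≤ E₂`, `|b₋₁| ≤ b̄`, `0 < c_min ≤ c₋₁ ≤ c̄`,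
`|∂ₜa₀| ≤ β₀` (`β₀ ≥ 0`), the defect bound of Lemma 6.9 `Ẽ₋₁ ≤ ½(a₋₁² + b₋₁² + c₋₁² + d₋₁²) + η₉`,
and the oscillation bound `∫ₛᵗ a₀ ≥ -λ` for `s₀ ≤ s ≤ t ≤ T'`. With `ρ = (1+ε₀)^{-5/2}ε⁻²`,
`M₁ = √(2E₁)`, `M₀ = √2`, `w₁ = 1/(ρc_min)`, `η_m = C₁(1+ε₀)^{-2-n₀/2}√E₁`,
`η₁ = (1+ε₀)^{-5/2}(2εE₁ + 2ε²e^{-K^{10}}E₁ + 2KE₂) + η_m`,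
`L = (1+ε₀)^{-5/2}ε⁻¹K^{10}b̄ + ((1+ε₀)^{-5/2}2ε²e^{-K^{10}}E₁ + η_m)/c_min`,
`θ₁ = 2K(1+ε₀)^{-5/2}E₂√(2E₁)`, `χ = ½Kw₁M₁²M₀`,
`g = θ₁ + ½Kw₁(KM₁²M₀² + (η₁ + η_m)M₁M₀ + M₁²β₀ + M₁²M₀L) + KM₀(χ + ½(b̄² + c̄²) + η₉)`:
for `t ∈ [s₀, T']`, `Ẽ₋₁(t) ≤ e^{Kλ}(Ẽ₋₁(s₀) + χ) + g(t - s₀)e^{Kλ} + χ`.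
[cite: Tao2016AveragedNS, §6.7 Prop. 6.17] -/
theorem RescaledHypotheses.coarse_energy_bound
    (h : RescaledHypotheses γ ε₀ K ε C₁ C₂ C₃ n₀ N τ Xr Er) (hε : 0 < ε) (hK : 0 < K) (hC₁ : 0 ≤ C₁)
    (hε₀ : 0 < ε₀) (hN : n₀ ≤ N) {s₀ T' E₁ E₂ bbar cmin cbar β₀ η₉ lam : ℝ} (hs₀ : 0 ≤ s₀)
    (hsT : s₀ ≤ T') (hcmin : 0 < cmin) (hβ₀ : 0 ≤ β₀) (hη₉ : 0 ≤ η₉)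
    (hreg : ∀ t ∈ Icc s₀ T', Er 0 t ≤ 1 ∧ Er (-1) t ≤ E₁ ∧ Er (-2) t ≤ E₂)
    (hb : ∀ t ∈ Icc s₀ T', |Xr 1 (-1) t| ≤ bbar)
    (hc : ∀ t ∈ Icc s₀ T', cmin ≤ Xr 2 (-1) t ∧ Xr 2 (-1) t ≤ cbar)
    (hβ : ∀ t ∈ Ico s₀ T', |derivWithin (Xr 0 0) (Ici (τ (n₀ - N))) t| ≤ β₀)
    (hdef : ∀ t ∈ Ico s₀ T', Er (-1) t ≤ (1 / 2) * ∑ i, Xr i (-1) t ^ 2 + η₉)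
    (hlam : ∀ s t, s₀ ≤ s → s ≤ t → t ≤ T' → -lam ≤ ∫ u in s..t, Xr 0 0 u)
    {t : ℝ} (ht : t ∈ Icc s₀ T') :
    let ρ : ℝ := (1 + ε₀) ^ (-((5 : ℝ) / 2)) * (ε ^ 2)⁻¹
    let M₁ : ℝ := Real.sqrt (2 * E₁)
    let M₀ : ℝ := Real.sqrt 2
    let w₁ : ℝ := 1 / (ρ * cmin)
    let ηm : ℝ := C₁ * (1 + ε₀) ^ (-2 - (n₀ : ℝ) / 2) * Real.sqrt E₁
    let η₁ : ℝ := (1 + ε₀) ^ (-((5 : ℝ) / 2)) *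
        (2 * ε * E₁ + 2 * ε ^ 2 * Real.exp (-K ^ 10) * E₁ + 2 * K * E₂) + ηm
    let L : ℝ := (1 + ε₀) ^ (-((5 : ℝ) / 2)) * (ε⁻¹ * K ^ 10) * bbar +
        ((1 + ε₀) ^ (-((5 : ℝ) / 2)) * (2 * ε ^ 2 * Real.exp (-K ^ 10) * E₁) + ηm) / cmin
    let θ₁ : ℝ := 2 * K * (1 + ε₀) ^ (-((5 : ℝ) / 2)) * E₂ * Real.sqrt (2 * E₁)
    let χ : ℝ := 1 / 2 * K * w₁ * (M₁ ^ 2 * M₀)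
    let g : ℝ := θ₁ + 1 / 2 * K * w₁ * (K * M₁ ^ 2 * M₀ ^ 2 + (η₁ + ηm) * M₁ * M₀ + M₁ ^ 2 * β₀ +
        M₁ ^ 2 * M₀ * L) + K * M₀ * (χ + 1 / 2 * (bbar ^ 2 + cbar ^ 2) + η₉)
    Er (-1) t ≤ Real.exp (K * lam) * (Er (-1) s₀ + χ) + g * (t - s₀) * Real.exp (K * lam) + χ := by
  intro ρ M₁ M₀ w₁ ηm η₁ L θ₁ χ g
  have hg_def : g = θ₁ + 1 / 2 * K * w₁ * (K * M₁ ^ 2 * M₀ ^ 2 + (η₁ + ηm) * M₁ * M₀ + M₁ ^ 2 * β₀ +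
      M₁ ^ 2 * M₀ * L) + K * M₀ * (χ + 1 / 2 * (bbar ^ 2 + cbar ^ 2) + η₉) := rfl
  have hχ_def : χ = 1 / 2 * K * w₁ * (M₁ ^ 2 * M₀) := rfl
  have hL_def : L = (1 + ε₀) ^ (-((5 : ℝ) / 2)) * (ε⁻¹ * K ^ 10) * bbar +
      ((1 + ε₀) ^ (-((5 : ℝ) / 2)) * (2 * ε ^ 2 * Real.exp (-K ^ 10) * E₁) + ηm) / cmin := rfl
  have hη₁_def : η₁ = (1 + ε₀) ^ (-((5 : ℝ) / 2)) *
      (2 * ε * E₁ + 2 * ε ^ 2 * Real.exp (-K ^ 10) * E₁ + 2 * K * E₂) + ηm := rfl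
  have hηm_def : ηm = C₁ * (1 + ε₀) ^ (-2 - (n₀ : ℝ) / 2) * Real.sqrt E₁ := rfl
  have hθ₁_def : θ₁ = 2 * K * (1 + ε₀) ^ (-((5 : ℝ) / 2)) * E₂ * Real.sqrt (2 * E₁) := rfl
  have hρ_def : ρ = (1 + ε₀) ^ (-((5 : ℝ) / 2)) * (ε ^ 2)⁻¹ := rfl
  have hw₁_def : w₁ = 1 / (ρ * cmin) := rfl
  have hM₁_def : M₁ = Real.sqrt (2 * E₁) := rfl
  have hM₀_def : M₀ = Real.sqrt 2 := rfl
  have hτ0 : τ (n₀ - N) ≤ 0 := h.tau_init_le hN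
  have hτs : τ (n₀ - N) ≤ s₀ := hτ0.trans hs₀
  have hq0 : (0 : ℝ) < 1 + ε₀ := by linarith
  have hρ : 0 < ρ := by rw [hρ_def]; positivity
  have hs₀m : s₀ ∈ Icc s₀ T' := ⟨le_rfl, hsT⟩
  have hE1 : 0 ≤ E₁ := (h.nonneg_F (-1) s₀ hτs).trans (hreg s₀ hs₀m).2.1
  have hE2 : 0 ≤ E₂ := (h.nonneg_F (-2) s₀ hτs).trans (hreg s₀ hs₀m).2.2
  have hbbar : 0 ≤ bbar := (abs_nonneg _).trans (hb s₀ hs₀m)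
  have hcbar : 0 < cbar := hcmin.trans_le ((hc s₀ hs₀m).1.trans (hc s₀ hs₀m).2)
  have hηm : 0 ≤ ηm := by rw [hηm_def]; positivity
  have hM₁ : 0 ≤ M₁ := by rw [hM₁_def]; exact Real.sqrt_nonneg _
  have hM₀ : 0 ≤ M₀ := by rw [hM₀_def]; exact Real.sqrt_nonneg _
  have hw₁ : 0 ≤ w₁ := by rw [hw₁_def]; positivity
  have hη₁ : 0 ≤ η₁ := by rw [hη₁_def]; positivity
  have hθ₁ : 0 ≤ θ₁ := by rw [hθ₁_def]; positivity
  have hL : 0 ≤ L := by rw [hL_def]; positivity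
  have hχ : 0 ≤ χ := by rw [hχ_def]; positivity
  have hg : 0 ≤ g := by rw [hg_def]; positivity
  clear_value ρ M₁ M₀ w₁ ηm η₁ L θ₁ χ g
  have hCpos : ∀ u ∈ Icc s₀ T', 0 < Xr 2 (-1) u := fun u hu => hcmin.trans_le (hc u hu).1
  -- the modified energy
  set Es : ℝ → ℝ := fun u => Er (-1) u -
    1 / 2 * K * (Xr 0 (-1) u * Xr 3 (-1) u * Xr 0 0 u / (ρ * Xr 2 (-1) u)) with hEs
  -- size of the modes
  have hAM : ∀ u ∈ Icc s₀ T', |Xr 0 (-1) u| ≤ M₁ := fun u hu => by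
    rw [hM₁_def]
    exact (h.abs_le_sqrt_energy 0 (-1) (hτs.trans hu.1)).trans
      (Real.sqrt_le_sqrt (by linarith [(hreg u hu).2.1]))
  have hDM : ∀ u ∈ Icc s₀ T', |Xr 3 (-1) u| ≤ M₁ := fun u hu => by
    rw [hM₁_def]
    exact (h.abs_le_sqrt_energy 3 (-1) (hτs.trans hu.1)).trans
      (Real.sqrt_le_sqrt (by linarith [(hreg u hu).2.1]))
  have haM : ∀ u ∈ Icc s₀ T', |Xr 0 0 u| ≤ M₀ := fun u hu => by
    rw [hM₀_def]
    exact (h.abs_le_sqrt_energy 0 0 (hτs.trans hu.1)).trans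
      (Real.sqrt_le_sqrt (by linarith [(hreg u hu).1]))
  -- `|½K corr| ≤ χ`
  have hcorr_le : ∀ u ∈ Icc s₀ T',
      |1 / 2 * K * (Xr 0 (-1) u * Xr 3 (-1) u * Xr 0 0 u / (ρ * Xr 2 (-1) u))| ≤ χ := by
    intro u hu
    have hCu := hCpos u hu
    have hw : 1 / (ρ * Xr 2 (-1) u) ≤ w₁ := by
      rw [hw₁_def]
      exact one_div_le_one_div_of_le (by positivity) (mul_le_mul_of_nonneg_left (hc u hu).1 hρ.le)
    have hnum : |Xr 0 (-1) u| * |Xr 3 (-1) u| * |Xr 0 0 u| ≤ M₁ * M₁ * M₀ :=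
      mul_le_mul (mul_le_mul (hAM u hu) (hDM u hu) (abs_nonneg _) hM₁) (haM u hu) (abs_nonneg _)
        (by positivity)
    have h1 : |Xr 0 (-1) u * Xr 3 (-1) u * Xr 0 0 u / (ρ * Xr 2 (-1) u)| ≤ M₁ ^ 2 * M₀ * w₁ := by
      rw [abs_div, abs_mul, abs_mul, abs_of_pos (by positivity : 0 < ρ * Xr 2 (-1) u),
        div_eq_mul_one_div]
      calc |Xr 0 (-1) u| * |Xr 3 (-1) u| * |Xr 0 0 u| * (1 / (ρ * Xr 2 (-1) u)) ≤
            M₁ * M₁ * M₀ * w₁ := mul_le_mul hnum hw (by positivity) (by positivity)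
        _ = M₁ ^ 2 * M₀ * w₁ := by ring
    rw [abs_mul, abs_of_nonneg (by positivity : (0 : ℝ) ≤ 1 / 2 * K), hχ_def]
    calc 1 / 2 * K * |Xr 0 (-1) u * Xr 3 (-1) u * Xr 0 0 u / (ρ * Xr 2 (-1) u)| ≤
          1 / 2 * K * (M₁ ^ 2 * M₀ * w₁) := mul_le_mul_of_nonneg_left h1 (by positivity)
      _ = 1 / 2 * K * w₁ * (M₁ ^ 2 * M₀) := by ring
  -- derivative of the modified energy and the supersolution inequality
  have hderiv : ∀ u ∈ Ico s₀ T', ∃ e' : ℝ, HasDerivWithinAt Es e' (Ici u) u ∧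
      e' ≤ -K * Xr 0 0 u * Es u + g := by
    intro u hu
    have hu' : u ∈ Icc s₀ T' := Ico_subset_Icc_self hu
    have hτu : τ (n₀ - N) ≤ u := hτs.trans hu.1
    have hCu := hCpos u hu'
    have hρC : ρ * Xr 2 (-1) u ≠ 0 := (mul_pos hρ hCu).ne'
    have hcd := correction_hasDerivWithinAt (ρ := ρ) (h.contDiffOn_Y 0 (-1)) (h.contDiffOn_Y 3 (-1))
      (h.contDiffOn_Y 0 0) (h.contDiffOn_Y 2 (-1)) hτu hρC
    have hEd := h.hasDeriv_E (-1) hτu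
    refine ⟨_, hEd.sub (hcd.const_mul (1 / 2 * K)), ?_⟩
    have hregu := hreg u hu'
    have he₁ := h.eq_a_neg_one hε.le hK.le hC₁ (by linarith) hτu hregu.2.1 hregu.2.2
    have he₄ := h.eq_d_neg_one hC₁ (by linarith) hτu hregu.2.1
    have hEn := h.energy_neg_one_deriv_le hK.le (by linarith) hτu hregu.2.1 hregu.2.2
    have hcder := h.coarse_c_deriv_abs_le hε hC₁ hε₀ hτu hregu.2.1
    -- `|C'| ≤ L C`
    have hcL : |derivWithin (Xr 2 (-1)) (Ici (τ (n₀ - N))) u| ≤ L * Xr 2 (-1) u := by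
      have hbu := hb u hu'
      have hCge := (hc u hu').1
      have h1 : |Xr 1 (-1) u| * |Xr 2 (-1) u| ≤ bbar * Xr 2 (-1) u := by
        rw [abs_of_pos hCu]
        exact mul_le_mul_of_nonneg_right hbu hCu.le
      have h2 : (1 + ε₀) ^ (-((5 : ℝ) / 2)) * (2 * ε ^ 2 * Real.exp (-K ^ 10) * E₁) + ηm ≤
          ((1 + ε₀) ^ (-((5 : ℝ) / 2)) * (2 * ε ^ 2 * Real.exp (-K ^ 10) * E₁) + ηm) / cmin *
            Xr 2 (-1) u := by
        rw [div_mul_eq_mul_div, le_div_iff₀ hcmin]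
        exact mul_le_mul_of_nonneg_left hCge (by positivity)
      have h3 := mul_le_mul_of_nonneg_left h1
        (show (0 : ℝ) ≤ (1 + ε₀) ^ (-((5 : ℝ) / 2)) * (ε⁻¹ * K ^ 10) by positivity)
      rw [hL_def]
      rw [hηm_def] at h2 ⊢
      have h4 : (1 + ε₀) ^ (-((5 : ℝ) / 2)) *
          (2 * ε ^ 2 * Real.exp (-K ^ 10) * E₁ + ε⁻¹ * K ^ 10 * (|Xr 1 (-1) u| * |Xr 2 (-1) u|)) +
          C₁ * (1 + ε₀) ^ (-2 - (n₀ : ℝ) / 2) * Real.sqrt E₁ ≤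
          ((1 + ε₀) ^ (-((5 : ℝ) / 2)) * (ε⁻¹ * K ^ 10) * bbar +
            ((1 + ε₀) ^ (-((5 : ℝ) / 2)) * (2 * ε ^ 2 * Real.exp (-K ^ 10) * E₁) +
              C₁ * (1 + ε₀) ^ (-2 - (n₀ : ℝ) / 2) * Real.sqrt E₁) / cmin) * Xr 2 (-1) u := by
        linarith only [h2, h3]
      exact hcder.trans h4
    have hw : 1 / (ρ * Xr 2 (-1) u) ≤ w₁ := by
      rw [hw₁_def]
      exact one_div_le_one_div_of_le (by positivity) (mul_le_mul_of_nonneg_left (hc u hu').1 hρ.le)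
    have hEn' : derivWithin (Er (-1)) (Ici (τ (n₀ - N))) u ≤ -K * Xr 3 (-1) u ^ 2 * Xr 0 0 u + θ₁ := by
      rw [hθ₁_def]; linarith only [hEn]
    have he₁' : |derivWithin (Xr 0 (-1)) (Ici (τ (n₀ - N))) u + ρ * Xr 2 (-1) u * Xr 3 (-1) u| ≤ η₁ := by
      rw [hη₁_def, hηm_def, hρ_def]; exact he₁
    have he₄' : |derivWithin (Xr 3 (-1)) (Ici (τ (n₀ - N))) u -
        (ρ * Xr 2 (-1) u * Xr 0 (-1) u - K * Xr 3 (-1) u * Xr 0 0 u)| ≤ ηm := by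
      rw [hηm_def, hρ_def]; exact he₄
    have halg := coarseModifiedEnergy_algebra (A := Xr 0 (-1) u) (D := Xr 3 (-1) u) (B := Xr 0 0 u)
      (C := Xr 2 (-1) u)
      (A' := derivWithin (Xr 0 (-1)) (Ici (τ (n₀ - N))) u)
      (D' := derivWithin (Xr 3 (-1)) (Ici (τ (n₀ - N))) u)
      (B' := derivWithin (Xr 0 0) (Ici (τ (n₀ - N))) u)
      (C' := derivWithin (Xr 2 (-1)) (Ici (τ (n₀ - N))) u)
      (Eder := derivWithin (Er (-1)) (Ici (τ (n₀ - N))) u)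
      hρ hK.le hCu hw hcL (hAM u hu') (hDM u hu') (haM u hu') (hβ u hu) he₁' he₄' hEn'
    -- the rate algebra
    have hsq : (1 / 2) * (Xr 0 (-1) u ^ 2 + Xr 3 (-1) u ^ 2) + (1 / 2) * (Xr 1 (-1) u ^ 2 + Xr 2 (-1) u ^ 2) ≤
        Er (-1) u := by
      have := h.defect_lower (-1) u hτu
      rw [Fin.sum_univ_four] at this
      linarith only [this]
    have hsq' : Er (-1) u ≤ (1 / 2) * (Xr 0 (-1) u ^ 2 + Xr 3 (-1) u ^ 2) +
        (1 / 2) * (Xr 1 (-1) u ^ 2 + Xr 2 (-1) u ^ 2) + η₉ := by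
      have := hdef u hu
      rw [Fin.sum_univ_four] at this
      linarith only [this]
    have hrate := coarse_rate_algebra (A := Xr 0 (-1) u) (D := Xr 3 (-1) u) (B := Xr 0 0 u)
      (E := Er (-1) u)
      (corr := 1 / 2 * K * (Xr 0 (-1) u * Xr 3 (-1) u * Xr 0 0 u / (ρ * Xr 2 (-1) u))) (χ := χ)
      (s := (1 / 2) * (Xr 1 (-1) u ^ 2 + Xr 2 (-1) u ^ 2)) (η₉ := η₉) (M₀ := M₀) (κ := K) hK.le
      (haM u hu') (hcorr_le u hu') (by positivity) hη₉ hsq hsq'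
    -- `s ≤ ½(b̄² + c̄²)`
    have hs : (1 / 2) * (Xr 1 (-1) u ^ 2 + Xr 2 (-1) u ^ 2) ≤ 1 / 2 * (bbar ^ 2 + cbar ^ 2) := by
      have h1 : Xr 1 (-1) u ^ 2 ≤ bbar ^ 2 := by
        rw [← sq_abs]
        exact pow_le_pow_left₀ (abs_nonneg _) (hb u hu') 2
      have h2 : Xr 2 (-1) u ^ 2 ≤ cbar ^ 2 := pow_le_pow_left₀ hCu.le (hc u hu').2 2
      linarith only [h1, h2]
    have hKM : K * M₀ * (χ + (1 / 2) * (Xr 1 (-1) u ^ 2 + Xr 2 (-1) u ^ 2) + η₉) ≤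
        K * M₀ * (χ + 1 / 2 * (bbar ^ 2 + cbar ^ 2) + η₉) :=
      mul_le_mul_of_nonneg_left (by linarith only [hs]) (by positivity)
    -- assemble
    have hEsu : Es u = Er (-1) u -
        1 / 2 * K * (Xr 0 (-1) u * Xr 3 (-1) u * Xr 0 0 u / (ρ * Xr 2 (-1) u)) := by
      simp only [hEs]
    rw [hEsu, hg_def]
    linarith only [halg, hrate, hKM]
  -- continuity of the modified energy
  have hEs_cont : ContinuousOn Es (Icc s₀ T') := by
    have hcA := h.continuousOn_X 0 (-1) hτs (b := T')
    have hcD := h.continuousOn_X 3 (-1) hτs (b := T')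
    have hcC := h.continuousOn_X 2 (-1) hτs (b := T')
    have hca := h.continuousOn_X 0 0 hτs (b := T')
    have hcE := h.continuousOn_E (-1) hτs (b := T')
    have hcorr_c : ContinuousOn (fun u => Xr 0 (-1) u * Xr 3 (-1) u * Xr 0 0 u / (ρ * Xr 2 (-1) u))
        (Icc s₀ T') :=
      ((hcA.mul hcD).mul hca).div (continuousOn_const.mul hcC) fun u hu => (mul_pos hρ (hCpos u hu)).ne'
    exact hcE.sub (continuousOn_const.mul hcorr_c)
  -- apply the oscillation lemma
  choose! e' he' using hderiv
  have hosc := le_of_oscillating_rate (E := Es) (E' := e') (a₀ := Xr 0 0) (κ := K) (g := g)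
    (lam := lam) hEs_cont (fun u hu => (he' u hu).1) (h.continuousOn_X 0 0 hτs) hK.le hg
    (fun u hu => (he' u hu).2) ht (fun s hs => hlam s t hs.1 hs.2 ht.2)
  -- unwind
  have hEt : Er (-1) t = Es t +
      1 / 2 * K * (Xr 0 (-1) t * Xr 3 (-1) t * Xr 0 0 t / (ρ * Xr 2 (-1) t)) := by
    simp only [hEs]; ring
  have hEs₀ : Es s₀ ≤ Er (-1) s₀ + χ := by
    have := (abs_le.mp (hcorr_le s₀ hs₀m)).1
    simp only [hEs]; linarith only [this]
  have hct := (abs_le.mp (hcorr_le t ht)).2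
  have hlam0 := hlam s₀ t le_rfl ht.1 ht.2
  have hexp : Real.exp (-(K * ∫ u in s₀..t, Xr 0 0 u)) ≤ Real.exp (K * lam) := by
    refine Real.exp_le_exp.2 ?_
    have := mul_le_mul_of_nonneg_left hlam0 hK.le
    linarith only [this]
  have hE₀ : 0 ≤ Er (-1) s₀ := h.nonneg_F (-1) s₀ hτs
  have hfirst : Real.exp (-(K * ∫ u in s₀..t, Xr 0 0 u)) * Es s₀ ≤
      Real.exp (K * lam) * (Er (-1) s₀ + χ) := by
    rcases le_or_gt 0 (Es s₀) with hpos | hneg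
    · exact mul_le_mul hexp hEs₀ hpos (Real.exp_pos _).le
    · have h1 : Real.exp (-(K * ∫ u in s₀..t, Xr 0 0 u)) * Es s₀ ≤ 0 :=
        mul_nonpos_of_nonneg_of_nonpos (Real.exp_pos _).le hneg.le
      have h2 : 0 ≤ Real.exp (K * lam) * (Er (-1) s₀ + χ) := by positivity
      linarith only [h1, h2]
  rw [hEt]
  linarith only [hosc, hfirst, hct]

end CoarseEnergy

end TaoCascade

end Literature.Analysis.FluidPDE
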